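import Literature.AlgebraicGeometry.Resolution.RsopMonomialIdeals
import Literature.AlgebraicGeometry.Resolution.NagataCriterion
import HarnessLib

/-!
# A part of a regular system of parameters stays one in the localisation at a prime containing it

Topic: `Literature/AlgebraicGeometry/Resolution`. Local algebra for the exceptionalisation
game on strict normal crossings divisors (moving from a closed point to the generic point of a
stratum): if `z₁, …, z_n` is part of a regular system of parameters of the regular local ring
`R` (`IsRsopPart z`, `RsopMonomialIdeals.lean`) and `q` is a prime ideal of `R` containing the
`zᵢ`, then the images of the `zᵢ` in the localisation `R_q` are part of a regular system of
parameters of `R_q`. Everything is PROVED: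

* `isLocalization_atPrime_quotient_map_of_le` — for `I ⊆ q`, `R_q / I R_q` is the localisation
  of `R/I` at `q/I` (any localisation `R_q` of `R` at `q`; the `Localization.AtPrime q` case is
  `isLocalization_atPrime_localization_quotient` of `NagataCriterion.lean`);
* `IsRsopPart.map_of_le_prime` — **the theorem**: `R_q` is regular (Serre, Matsumura
  Thm. 19.3, tree: `isRegularLocalRing_localization_atPrime`), `R_q/(z)R_q = (R/(z))_{q/(z)}`
  is regular for the same reason since `R/(z)` is regular (Matsumura Thm. 14.2,
  `IsRsopPart.isRegularLocalRing_quotient`), and the dimensions add up,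
  `dim R_q/(z)R_q + n = ht(q/(z)) + n ≤ ht(q/(z)) + ht (z) ≤ ht q = dim R_q` (the chain of
  primes `(z₁, …, z_c)`, `c ≤ n`, Matsumura Thm. 14.3, and concatenation of chains), so the
  criterion `IsRsopPart.of_isRegularLocalRing_quotient` (Matsumura, Remark after Thm. 14.2)
  applies;
* `IsRsopPart.comp_map_of_le_prime` — the sub-family form: for `ι : Fin m → Fin n` injective
  with `z (ι j) ∈ q` for all `j` (no condition on the other `zᵢ`), the images of the `z (ι j)`
  in `R_q` are part of a regular system of parameters;
* `IsRsopPart.map_localization_atPrime`, `IsRsopPart.height_span_range` — the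
  `Localization.AtPrime q` specialisation, and the by-product `ht (z₁, …, z_n) = n`.

Only the easy inequality `ht P + ht(Q/P) ≤ ht Q` (`height_add_height_map_quotientMk_le`) is
used, not the catenarity of regular local rings (Matsumura Thm. 17.4), which would give the
equality directly.

## Sources

* H. Matsumura, *Commutative Ring Theory*, Cambridge Stud. Adv. Math. 8, CUP 1986: Thm. 14.2 and
  the Remark following it, Thm. 14.3, Thm. 17.4 (iii), Thm. 19.3 (Serre). [Matsumura1987]
-/

noncomputable section

namespace Literature.AlgebraicGeometry.Resolution

universe u

open IsLocalRing

/-! ## Localising a quotient at a prime: `R_q / I R_q = (R/I)_{q/I}` -/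

/-- For an ideal `I ⊆ q` (`q` prime) and any localisation `R_q` of `R` at `q`, the ring
`R_q / I R_q` is the localisation of `R/I` at the prime `q/I` (Mathlib's
`IsLocalization.of_surjective` instance, with `(R ∖ q) mod I = (R/I) ∖ (q/I)`). [folklore] -/
theorem isLocalization_atPrime_quotient_map_of_le {R : Type*} [CommRing R] (I q : Ideal R)
    [q.IsPrime] [(q.map (Ideal.Quotient.mk I)).IsPrime] (hIq : I ≤ q)
    (Rq : Type*) [CommRing Rq] [Algebra R Rq] [IsLocalization.AtPrime Rq q] :
    IsLocalization.AtPrime (Rq ⧸ I.map (algebraMap R Rq)) (q.map (Ideal.Quotient.mk I)) := by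
  -- adapted from `isLocalization_atPrime_localization_quotient` (`NagataCriterion.lean`)
  have hcomap : (q.map (Ideal.Quotient.mk I)).comap (Ideal.Quotient.mk I) = q := by
    rw [Ideal.comap_map_of_surjective _ Ideal.Quotient.mk_surjective, ← RingHom.ker_eq_comap_bot,
      Ideal.mk_ker, sup_eq_left]
    exact hIq
  have hmem : ∀ c : R, Ideal.Quotient.mk I c ∈ q.map (Ideal.Quotient.mk I) ↔ c ∈ q :=
    fun c => by rw [← Ideal.mem_comap, hcomap]
  have hM : Algebra.algebraMapSubmonoid (R ⧸ I) q.primeCompl =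
      (q.map (Ideal.Quotient.mk I)).primeCompl := by
    ext b
    constructor
    · rintro ⟨c, hc, rfl⟩
      exact fun h => hc ((hmem c).mp h)
    · intro hb
      obtain ⟨c, rfl⟩ := Ideal.Quotient.mk_surjective b
      exact ⟨c, fun h => hb ((hmem c).mpr h), rfl⟩
  have h := (inferInstance : IsLocalization (Algebra.algebraMapSubmonoid (R ⧸ I) q.primeCompl)
      (Rq ⧸ I.map (algebraMap R Rq)))
  unfold IsLocalization.AtPrime
  rwa [hM] at h

/-! ## The height of the ideal of a part of a regular system of parameters -/

/-- The ideal generated by `n` members of a regular system of parameters has height `≥ n`: the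
ideals generated by the first `c` members, `c = 0, …, n`, form a strictly increasing chain of
primes (Matsumura Thm. 14.3 and minimality). Private copy of
`IsRsopPart.natCast_le_height_span_range` (`FormalNodeRingSingularCodimTwo.lean`), to keep the
imports of this file light. [cite: Matsumura1987, Thm. 14.3] -/
private theorem IsRsopPart.natCast_le_height_span_range_aux {R : Type u} [CommRing R]
    [IsLocalRing R] :
    ∀ {n : ℕ} {z : Fin n → R}, IsRsopPart z → (n : ℕ∞) ≤ (Ideal.span (Set.range z)).height
  -- adapted from `IsRsopPart.natCast_le_height_span_range`
  -- (`FormalNodeRingSingularCodimTwo.lean`)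
  | 0, _, _ => by simp
  | n + 1, z, hz => by
    have hz' : IsRsopPart (z ∘ Fin.castSucc) := hz.comp Fin.castSucc (Fin.castSucc_injective n)
    have ih := IsRsopPart.natCast_le_height_span_range_aux hz'
    haveI := hz'.isPrime_span_range
    haveI := hz.isPrime_span_range
    have hlt : Ideal.span (Set.range (z ∘ Fin.castSucc)) < Ideal.span (Set.range z) := by
      refine lt_of_le_of_ne (Ideal.span_mono (Set.range_comp_subset_range _ _)) fun heq => ?_
      have hmem : z (Fin.last n) ∈ Ideal.span (Set.range (z ∘ Fin.castSucc)) := by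
        rw [heq]
        exact Ideal.subset_span ⟨Fin.last n, rfl⟩
      rw [Set.range_comp] at hmem
      refine hz.not_mem_span_image (S := Set.range Fin.castSucc) (i := Fin.last n) ?_ hmem
      rintro ⟨j, hj⟩
      exact Fin.castSucc_ne_last j hj
    have h := Ideal.height_add_one_le_of_lt_of_isPrime hlt
    calc ((n + 1 : ℕ) : ℕ∞) = (n : ℕ∞) + 1 := by push_cast; rfl
      _ ≤ (Ideal.span (Set.range (z ∘ Fin.castSucc))).height + 1 := add_le_add ih le_rfl
      _ ≤ (Ideal.span (Set.range z)).height := h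

/-! ## Localising a part of a regular system of parameters -/

/-- **A part of a regular system of parameters stays one in the localisation at any prime
containing it.** Let `z₁, …, z_n` be part of a regular system of parameters of the (regular)
local ring `R`, let `q` be a prime ideal of `R` with `zᵢ ∈ q` for all `i`, and let `R_q` be a
localisation of `R` at `q`. Then the images of the `zᵢ` in `R_q` are part of a regular system of
parameters of `R_q`. Proof: `R_q/(z)R_q = (R/(z))_{q/(z)}` is a localisation of the regular local
ring `R/(z)` (Matsumura Thm. 14.2), hence regular (Serre, Thm. 19.3), and
`dim R_q/(z)R_q + n = ht(q/(z)) + n ≤ ht(q/(z)) + ht (z) ≤ ht q = dim R_q` (Thm. 14.3 for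
`n ≤ ht (z)`, and concatenation of chains of primes), so Matsumura's criterion (Remark after
Thm. 14.2, `IsRsopPart.of_isRegularLocalRing_quotient`) applies. [folklore] -/
theorem IsRsopPart.map_of_le_prime {R : Type u} [CommRing R] [IsLocalRing R] {n : ℕ}
    {z : Fin n → R} (hz : IsRsopPart z) (q : Ideal R) [q.IsPrime] (hq : ∀ i, z i ∈ q)
    (Rq : Type u) [CommRing Rq] [Algebra R Rq] [IsLocalization.AtPrime Rq q] [IsLocalRing Rq] :
    IsRsopPart (fun i => algebraMap R Rq (z i)) := by
  haveI := hz.isRegularLocalRing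
  haveI : IsNoetherianRing Rq := IsLocalization.isNoetherianRing q.primeCompl Rq inferInstance
  -- the prime `I = (z)` and its image `q/I` in the regular local ring `R/I`
  set I : Ideal R := Ideal.span (Set.range z) with hI
  haveI hIp : I.IsPrime := hz.isPrime_span_range
  have hIq : I ≤ q := by
    rw [hI, Ideal.span_le]
    rintro _ ⟨i, rfl⟩
    exact hq i
  have hspan : Ideal.span (Set.range fun i => algebraMap R Rq (z i)) =
      I.map (algebraMap R Rq) := by
    rw [hI, Ideal.map_span, ← Set.range_comp]
    rfl
  haveI hqI : (q.map (Ideal.Quotient.mk I)).IsPrime :=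
    Ideal.isPrime_map_quotientMk_of_isPrime hIq
  haveI hloc : IsLocalization.AtPrime (Rq ⧸ I.map (algebraMap R Rq))
      (q.map (Ideal.Quotient.mk I)) :=
    isLocalization_atPrime_quotient_map_of_le I q hIq Rq
  -- (a) `R_q / (z) R_q = (R/(z))_{q/(z)}` is a regular local ring (Matsumura 14.2 + Serre 19.3)
  haveI : IsRegularLocalRing (R ⧸ I) := hz.isRegularLocalRing_quotient
  haveI : IsRegularLocalRing (Localization.AtPrime (q.map (Ideal.Quotient.mk I))) :=
    isRegularLocalRing_localization_atPrime _ _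
  haveI hreg :
      IsRegularLocalRing (Rq ⧸ Ideal.span (Set.range fun i => algebraMap R Rq (z i))) := by
    rw [hspan]
    exact IsRegularLocalRing.of_ringEquiv (IsLocalization.algEquiv
      (q.map (Ideal.Quotient.mk I)).primeCompl
      (Localization.AtPrime (q.map (Ideal.Quotient.mk I)))
      (Rq ⧸ I.map (algebraMap R Rq))).toRingEquiv
  -- (b) the criterion: `zᵢ ∈ q R_q` and `dim R_q/(z)R_q + n ≤ dim R_q`
  refine IsRsopPart.of_isRegularLocalRing_quotient (fun i => ?_) ?_
  · exact (IsLocalization.AtPrime.to_map_mem_maximal_iff Rq q (z i)).mpr (hq i)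
  · rw [hspan, IsLocalization.AtPrime.ringKrullDim_eq_height (q.map (Ideal.Quotient.mk I))
        (Rq ⧸ I.map (algebraMap R Rq)), IsLocalization.AtPrime.ringKrullDim_eq_height q Rq]
    have h1 : (n : ℕ∞) ≤ I.height := IsRsopPart.natCast_le_height_span_range_aux hz
    have h2 : I.height + (q.map (Ideal.Quotient.mk I)).height ≤ q.height :=
      height_add_height_map_quotientMk_le hIq
    have h3 : (q.map (Ideal.Quotient.mk I)).height + (n : ℕ∞) ≤ q.height :=
      calc (q.map (Ideal.Quotient.mk I)).height + (n : ℕ∞)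
          ≤ (q.map (Ideal.Quotient.mk I)).height + I.height := add_le_add le_rfl h1
        _ = I.height + (q.map (Ideal.Quotient.mk I)).height := add_comm _ _
        _ ≤ q.height := h2
    exact_mod_cast h3

/-- **Sub-family form** (the shape used when passing to the generic point of a stratum): if
`z₁, …, z_n` is part of a regular system of parameters of `R`, `ι : Fin m → Fin n` is injective
and the prime `q` contains the `z (ι j)` (no condition on the other `zᵢ`), then the images of the
`z (ι j)` in a localisation `R_q` of `R` at `q` are part of a regular system of parameters of
`R_q` (`IsRsopPart.comp` and `IsRsopPart.map_of_le_prime`). [folklore] -/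
theorem IsRsopPart.comp_map_of_le_prime {R : Type u} [CommRing R] [IsLocalRing R] {n : ℕ}
    {z : Fin n → R} (hz : IsRsopPart z) {m : ℕ} (ι : Fin m → Fin n) (hι : Function.Injective ι)
    (q : Ideal R) [q.IsPrime] (hq : ∀ j, z (ι j) ∈ q)
    (Rq : Type u) [CommRing Rq] [Algebra R Rq] [IsLocalization.AtPrime Rq q] [IsLocalRing Rq] :
    IsRsopPart (fun j => algebraMap R Rq (z (ι j))) :=
  (hz.comp ι hι).map_of_le_prime q (fun j => hq j) Rq

/-- The `Localization.AtPrime` form: the images of a part `z₁, …, z_n` of a regular system of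
parameters in `R_q = Localization.AtPrime q`, `q ∋ zᵢ` prime, are part of a regular system of
parameters of `R_q`. [folklore] -/
theorem IsRsopPart.map_localization_atPrime {R : Type u} [CommRing R] [IsLocalRing R] {n : ℕ}
    {z : Fin n → R} (hz : IsRsopPart z) (q : Ideal R) [q.IsPrime] (hq : ∀ i, z i ∈ q) :
    IsRsopPart (fun i => algebraMap R (Localization.AtPrime q) (z i)) :=
  hz.map_of_le_prime q hq (Localization.AtPrime q)

/-- **The ideal of a part `z₁, …, z_n` of a regular system of parameters has height `n`**
(Matsumura Thm. 17.4 (iii) with Thm. 17.8: `ht(x₁, …, xᵢ) = i` for a regular sequence in a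
Cohen–Macaulay local ring). Here: in the localisation `R_{(z)}` at the prime `(z)` the `zᵢ` are
part of a regular system of parameters (`IsRsopPart.map_of_le_prime`) generating the maximal
ideal, so `ht (z) = dim R_{(z)} = dim R_{(z)}/(z)R_{(z)} + n = 0 + n` (Thm. 14.2).
[cite: Matsumura1987, Thm. 17.4 (iii)] -/
theorem IsRsopPart.height_span_range {R : Type u} [CommRing R] [IsLocalRing R] {n : ℕ}
    {z : Fin n → R} (hz : IsRsopPart z) : (Ideal.span (Set.range z)).height = n := by
  haveI := hz.isRegularLocalRing
  set I : Ideal R := Ideal.span (Set.range z) with hI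
  haveI hIp : I.IsPrime := hz.isPrime_span_range
  have hzI : ∀ i, z i ∈ I := fun i => Ideal.subset_span ⟨i, rfl⟩
  -- in `R_I` the `zᵢ` are part of a regular system of parameters generating the maximal ideal
  have hloc := hz.map_of_le_prime I hzI (Localization.AtPrime I)
  have hdim := hloc.ringKrullDim_quotient_add
  have hspan : Ideal.span (Set.range fun i => algebraMap R (Localization.AtPrime I) (z i)) =
      maximalIdeal (Localization.AtPrime I) := by
    rw [← Localization.AtPrime.map_eq_maximalIdeal]
    change _ = Ideal.map _ (Ideal.span (Set.range z))
    rw [Ideal.map_span, ← Set.range_comp]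
    rfl
  rw [hspan, IsLocalization.AtPrime.ringKrullDim_eq_height I (Localization.AtPrime I)] at hdim
  haveI : IsField (Localization.AtPrime I ⧸ maximalIdeal (Localization.AtPrime I)) :=
    (Ideal.Quotient.maximal_ideal_iff_isField_quotient _).mp inferInstance
  rw [ringKrullDim_eq_zero_of_isField this, zero_add] at hdim
  exact_mod_cast hdim.symm

end Literature.AlgebraicGeometry.Resolution

end
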